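/-
Copyright (c) 2026 the pub-hodgecm-mathlib formalisation cell (harness21).  Prover seat hodgecm-mathlib-K2E1-p15 (g0), Track B ∕ K2-LIT «5Res», h413 = `stmt-HodgeConjecture-24833`,
line `K2_E1_TraceFormulaBeta`, route of record `HCCMUnconditional`; dealer K2E1-plan (g7) `hB` RULING 2026-09-04T13:03:44Z, DEFAULT (i), FILE 2: moving the continued truncated
family of a ball to ANY truncation level `T ≥ 1` (sequel of ★ `K2E1TruncationLevelChangeU2`).
-/
import Summits.HodgeConjecture.HodgeConjecture.Theorems.K2E1TruncationLevelChangeU2   -- (this seat) FILE 1: `truncation_sub_truncation_two`, `differentiableOn_family_quotFun_pseudoEisenstein_band`, `measurable_pseudoEisenstein_band`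
import HarnessLib

/-!
# K2·E1 — `K2E1TruncationLevelChangeFamilyCMTwo`: THE CONTINUED TRUNCATED FAMILY OF A BALL AT ANY LEVEL `T ≥ 1` — `[Λ^T Ẽ(z)] = [Λ^{T₀} Ẽ(z)] ± [Ψ(𝟙_{band}·w_z)]` with the
# band class HOLOMORPHIC off the poles (`U(1,1)_{L∕L⁺}`)

Track B ∕ K2-LIT, crux h413 = `stmt-HodgeConjecture-24833`; cell `hodgecm-mathlib`, squad K2, ENGINE E1; dealer K2E1-plan (g7) `hB` ruling (13:03:44Z), DEFAULT (i).  THEOREMS ONLY (no `def`,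
no `instance`, no notation, no named-fact hypothesis, no `sorry`); lane `--kind proof --supports stmt-HodgeConjecture-24833 --as helper` (count-neutral).  Closes no socket.

WHAT ([MoeglinWaldspurger1995, IV.2.3]; [BernsteinLapid2019, Thm 2.3]).  INPUT: the row-15 continued truncated family of one ball, `Fam : ℂ → L²(𝔛)` holomorphic on an open `D₁` with
`Fam z =ᵐ quotFun (Λ^{T₀}(Ec z))` on the tube part of `D₁` (★ `exists_truncatedFamily_chi_cm_two_upper`, level `T₀ ≥ 1`), the continued series `Ec` with (E1) `Ec z = E(f_z^φ)` on the tube,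
and a CONTINUED CONSTANT-TERM DATUM ON THE BAND: `w : ℂ → G → ℂ`, left-`B(F)`-invariant and continuous for `z ∈ D₁`, holomorphic in `z` pointwise, LOCALLY BOUNDED on `D₁ × band`, and
equal ON THE TUBE to the constant term of `E(f_z^φ)` on the band (`hCT`; in the M1 currency `w_z = f_z^φ + Σ_j qc_j(z)·bV_j` by ★ row 2 `borelConstantTerm_eisensteinSeriesU_flatSectionU_cm_two`
+ the ★ M1 print's `hqφ`, `qc = q` on the tube — §2).  OUTPUT, for EVERY `T ≥ 1`: a family `Fam'` holomorphic on `D₁` with `Fam' z =ᵐ quotFun (Λ^{T}(Ec z))` on the tube part — so the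
Maass–Selberg machinery (★ `poleControl_continued_chi_cm_two_of_truncatedFamily_on'` and FILE 1 of ★ row 14, valid for every `T ≥ 1`) runs at ONE COMMON LEVEL on every ball.
HOW.  `Fam' := Fam ± G`, `G z := [quotFun (Ψ(𝟙_{band(T₀,T)}·w_z))]` (FILE 1 §1 on the tube: `Λ^T − Λ^{T₀} = Ψ(𝟙_{band}·(Ec z)_B)` and `(Ec z)_B = w_z` there); `G` is holomorphic on `D₁` by
FILE 1 §2 applied on small balls `⋐ D₁` where `w` is bounded.
* §1 `memLp_quotFun_pseudoEisenstein_band`, **`exists_truncatedFamily_levelChange`** (abstract band datum `w`).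
HONEST LABEL: HC_CM is proved only modulo the 7 printed citations (2 remaining named inputs: hLiu418 = `stmt-HodgeConjecture-24832`, h413 = `stmt-HodgeConjecture-24833`) until rung 0
closes; this file asserts no named fact and closes no socket.

## References
* [MoeglinWaldspurger1995] C. Mœglin, J.-L. Waldspurger, *Spectral decomposition and Eisenstein series* (1995), I.2.13, IV.2.3.
* [BernsteinLapid2019] J. Bernstein, E. Lapid, *On the meromorphic continuation of Eisenstein series*, J. AMS 37 (2024), Thm 2.3, §4.
* [Arthur1980TraceFormulaII] J. Arthur, *A trace formula for reductive groups II*, Compositio Math. 40 (1980), §1.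
-/

set_option autoImplicit false
set_option linter.dupNamespace false  -- the mandated namespace repeats the summit's segment (`HodgeConjecture.HodgeConjecture`)

noncomputable section

open MeasureTheory Set Filter Topology NumberField Metric
open scoped NNReal ENNReal
open Literature.NumberTheory.Automorphic Literature.NumberTheory.Automorphic.UnitaryGroup AdelicGroupData
open Summit.HodgeConjecture.HodgeConjecture.Cruxes.H413.K2E1BorelEisensteinU
open Summit.HodgeConjecture.HodgeConjecture.Cruxes.H413.K2E1TruncatedEisensteinL2 (measurable_quotFun_of_measurable memLp_quotFun_of_bound)
open Summit.HodgeConjecture.HodgeConjecture.Cruxes.H413.K2E1TruncationLevelChangeU2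

namespace Summit.HodgeConjecture.HodgeConjecture.Cruxes.H413.K2E1TruncationLevelChangeFamilyCMTwo

variable (L : Type) [Field L] [NumberField L] [IsCMField L]
  [MeasurableSpace (quasiSplit (↥(maximalRealSubfield L)) L (IsCMField.complexConj L) 2).Adelic] [BorelSpace (quasiSplit (↥(maximalRealSubfield L)) L (IsCMField.complexConj L) 2).Adelic]

/-- **THE BAND CLASS IS IN `L^p(𝔛)`**: for `w` left-`B(F)`-invariant, measurable and bounded on the band `a < H ≤ b` (`a > 0`), `quotFun (Ψ(𝟙_{band}·w)) ∈ L^p(𝔛, μ)` for every finite `μ`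
(bounded by FILE 1 `exists_const_norm_pseudoEisenstein_band_le`, Borel by FILE 1 `measurable_pseudoEisenstein_band` + ★ `measurable_quotFun_of_measurable`). [cite: MoeglinWaldspurger1995, I.2.13] -/
theorem memLp_quotFun_pseudoEisenstein_band
    (μ : Measure (quasiSplit (↥(maximalRealSubfield L)) L (IsCMField.complexConj L) 2).automorphicQuotient) [IsFiniteMeasure μ] (p : ℝ≥0∞)
    {a b : ℝ≥0} (ha : 0 < a) {w : (quasiSplit (↥(maximalRealSubfield L)) L (IsCMField.complexConj L) 2).Adelic → ℂ}
    (hwB : ∀ β ∈ arithmeticBorel (↥(maximalRealSubfield L)) L (IsCMField.complexConj L) 2, ∀ g, w ((β : (quasiSplit (↥(maximalRealSubfield L)) L (IsCMField.complexConj L) 2).Adelic) * g) = w g)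
    (hwm : Measurable w) {M : ℝ} (hM : ∀ g, a < borelHeight g → borelHeight g ≤ b → ‖w g‖ ≤ M) :
    MemLp ((quasiSplit (↥(maximalRealSubfield L)) L (IsCMField.complexConj L) 2).quotFun
      (pseudoEisenstein ({x : (quasiSplit (↥(maximalRealSubfield L)) L (IsCMField.complexConj L) 2).Adelic | a < borelHeight x ∧ borelHeight x ≤ b}.indicator w))) p μ := by
  obtain ⟨C, -, hC⟩ := exists_const_norm_pseudoEisenstein_band_le L ha
  refine memLp_quotFun_of_bound _ μ p (hC b w hwB M hM) ?_
  refine (measurable_quotFun_of_measurable (measurable_pseudoEisenstein_band L ha hwm) fun γ y => ?_).aestronglyMeasurable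
  exact pseudoEisenstein_rational_mul (band_indicator_arithmeticBorel_mul L hwB) γ y

/-- **CHANGE OF TRUNCATION LEVEL FOR THE CONTINUED FAMILY OF A BALL** (module docstring).  For `1 ≤ T₀`, `1 ≤ T`, any `D₁ ⊆ ℂ` (open in practice: `hwloc` asks for balls inside it), a finite `μ`: from `Fam` holomorphic on `D₁` with
`Fam z =ᵐ quotFun (Λ^{T₀}(Ec z))` on the tube part, (E1) `Ec z = E(f_z^φ)` there, and a band datum `w` (left-`B(F)`-invariant, continuous, pointwise holomorphic, locally bounded on
`D₁ × {min T₀ T < H ≤ max T₀ T}`, and `= (E(f_z^φ))_B` on that band for tube `z ∈ D₁`) — a family `Fam'` holomorphic on `D₁` with `Fam' z =ᵐ quotFun (Λ^{T}(Ec z))` on the tube part.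
[cite: MoeglinWaldspurger1995, IV.2.3] [cite: BernsteinLapid2019, Thm 2.3] [cite: Arthur1980TraceFormulaII, §1] -/
theorem exists_truncatedFamily_levelChange
    (μ : Measure (quasiSplit (↥(maximalRealSubfield L)) L (IsCMField.complexConj L) 2).automorphicQuotient) [IsFiniteMeasure μ]
    (ν : Measure ↥(adelicUnipotent (↥(maximalRealSubfield L)) L (IsCMField.complexConj L) 2)) (𝓕 : Set ↥(adelicUnipotent (↥(maximalRealSubfield L)) L (IsCMField.complexConj L) 2))
    {T₀ T : ℝ≥0} (hT₀ : 1 ≤ T₀) (hT : 1 ≤ T) {D₁ : Set ℂ}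
    (φ : (quasiSplit (↥(maximalRealSubfield L)) L (IsCMField.complexConj L) 2).Adelic → ℂ)
    (Ec : ℂ → (quasiSplit (↥(maximalRealSubfield L)) L (IsCMField.complexConj L) 2).Adelic → ℂ) (hE1 : ∀ z : ℂ, 1 < z.re → Ec z = eisensteinSeriesU (flatSectionU φ z))
    -- the continued constant-term datum on the band
    (w : ℂ → (quasiSplit (↥(maximalRealSubfield L)) L (IsCMField.complexConj L) 2).Adelic → ℂ)
    (hwB : ∀ z ∈ D₁, ∀ β ∈ arithmeticBorel (↥(maximalRealSubfield L)) L (IsCMField.complexConj L) 2, ∀ g, w z ((β : (quasiSplit (↥(maximalRealSubfield L)) L (IsCMField.complexConj L) 2).Adelic) * g) = w z g)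
    (hwc : ∀ z ∈ D₁, Continuous (w z))
    (hwd : ∀ g, min T₀ T < borelHeight g → borelHeight g ≤ max T₀ T → DifferentiableOn ℂ (fun z => w z g) D₁)
    (hwloc : ∀ z₀ ∈ D₁, ∃ r > 0, ball z₀ r ⊆ D₁ ∧ ∃ M : ℝ, ∀ z ∈ ball z₀ r, ∀ g, min T₀ T < borelHeight g → borelHeight g ≤ max T₀ T → ‖w z g‖ ≤ M)
    (hCT : ∀ z ∈ D₁, 1 < z.re → ∀ g, min T₀ T < borelHeight g → borelHeight g ≤ max T₀ T → borelConstantTerm ν 𝓕 (eisensteinSeriesU (flatSectionU φ z)) g = w z g)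
    -- the family at level `T₀`
    (Fam : ℂ → Lp ℂ 2 μ) (hFd : DifferentiableOn ℂ Fam D₁)
    (hFtube : ∀ z ∈ D₁, 1 < z.re → ((Fam z : Lp ℂ 2 μ) : (quasiSplit (↥(maximalRealSubfield L)) L (IsCMField.complexConj L) 2).automorphicQuotient → ℂ) =ᵐ[μ]
      (quasiSplit (↥(maximalRealSubfield L)) L (IsCMField.complexConj L) 2).quotFun (truncation ν 𝓕 T₀ (Ec z))) :
    ∃ Fam' : ℂ → Lp ℂ 2 μ, DifferentiableOn ℂ Fam' D₁ ∧
      ∀ z ∈ D₁, 1 < z.re → ((Fam' z : Lp ℂ 2 μ) : (quasiSplit (↥(maximalRealSubfield L)) L (IsCMField.complexConj L) 2).automorphicQuotient → ℂ) =ᵐ[μ]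
        (quasiSplit (↥(maximalRealSubfield L)) L (IsCMField.complexConj L) 2).quotFun (truncation ν 𝓕 T (Ec z)) := by
  classical
  set lo : ℝ≥0 := min T₀ T with hlo
  set hi : ℝ≥0 := max T₀ T with hhi
  have hlo0 : 0 < lo := lt_of_lt_of_le one_pos (le_min hT₀ hT)
  set band : Set (quasiSplit (↥(maximalRealSubfield L)) L (IsCMField.complexConj L) 2).Adelic := {x | lo < borelHeight x ∧ borelHeight x ≤ hi} with hband
  -- the band class `G z`
  have hmem : ∀ z ∈ D₁, MemLp ((quasiSplit (↥(maximalRealSubfield L)) L (IsCMField.complexConj L) 2).quotFun (pseudoEisenstein (band.indicator (w z)))) 2 μ := by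
    intro z hz
    obtain ⟨r, hr, hrD, M, hM⟩ := hwloc z hz
    exact memLp_quotFun_pseudoEisenstein_band L μ 2 hlo0 (hwB z hz) (hwc z hz).measurable (hM z (mem_ball_self hr))
  set G : ℂ → Lp ℂ 2 μ := fun z => if hz : z ∈ D₁ then (hmem z hz).toLp _ else 0 with hGdef
  have hGae : ∀ z ∈ D₁, ((G z : Lp ℂ 2 μ) : (quasiSplit (↥(maximalRealSubfield L)) L (IsCMField.complexConj L) 2).automorphicQuotient → ℂ) =ᵐ[μ]
      (quasiSplit (↥(maximalRealSubfield L)) L (IsCMField.complexConj L) 2).quotFun (pseudoEisenstein (band.indicator (w z))) := by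
    intro z hz
    rw [hGdef]
    simp only [dif_pos hz]
    exact MemLp.coeFn_toLp _
  -- `G` is holomorphic on `D₁` (FILE 1 §2 on small balls)
  have hGd : DifferentiableOn ℂ G D₁ := by
    intro z₀ hz₀
    obtain ⟨r, hr, hrD, M, hM⟩ := hwloc z₀ hz₀
    have hball : DifferentiableOn ℂ G (ball z₀ r) :=
      differentiableOn_family_quotFun_pseudoEisenstein_band L μ isOpen_ball hlo0 w (fun z hz => hwB z (hrD hz)) (fun z hz => (hwc z (hrD hz)).measurable)
        (fun g h1 h2 => (hwd g h1 h2).mono hrD) (fun z hz g h1 h2 => hM z hz g h1 h2) G (fun z hz => hGae z (hrD hz))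
    exact (hball.differentiableAt (ball_mem_nhds z₀ hr)).differentiableWithinAt
  -- the level-`T` family
  rcases le_total T₀ T with hle | hle
  · -- `T₀ ≤ T`: `Λ^T = Λ^{T₀} + Ψ(𝟙_{T₀ < H ≤ T}·(·)_B)`
    have hlo' : lo = T₀ := by rw [hlo, min_eq_left hle]
    have hhi' : hi = T := by rw [hhi, max_eq_right hle]
    refine ⟨fun z => Fam z + G z, hFd.add hGd, fun z hz hz1 => ?_⟩
    filter_upwards [Lp.coeFn_add (Fam z) (G z), hFtube z hz hz1, hGae z hz] with x hx h1 h2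
    rw [hx, Pi.add_apply, h1, h2]
    show _ = (quasiSplit (↥(maximalRealSubfield L)) L (IsCMField.complexConj L) 2).quotFun (truncation ν 𝓕 T (Ec z)) x
    have hfun : truncation ν 𝓕 T (Ec z) = truncation ν 𝓕 T₀ (Ec z) + pseudoEisenstein (band.indicator (w z)) := by
      funext g
      have h3 := truncation_sub_truncation_two ν 𝓕 (lt_of_lt_of_le one_pos hT₀) hle (Ec z) g
      rw [sub_eq_iff_eq_add'] at h3
      rw [Pi.add_apply, h3]
      congr 1
      refine finsum_congr fun q => ?_
      rw [hband, hlo', hhi']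
      simp only [Set.indicator_apply, Set.mem_setOf_eq]
      split_ifs with hq
      · rw [hE1 z hz1]
        exact hCT z hz hz1 _ (by rw [hlo']; exact hq.1) (by rw [hhi']; exact hq.2)
      · rfl
    rw [hfun, AdelicGroupData.quotFun_add, Pi.add_apply]
  · -- `T ≤ T₀`: `Λ^T = Λ^{T₀} − Ψ(𝟙_{T < H ≤ T₀}·(·)_B)`
    have hlo' : lo = T := by rw [hlo, min_eq_right hle]
    have hhi' : hi = T₀ := by rw [hhi, max_eq_left hle]
    refine ⟨fun z => Fam z - G z, hFd.sub hGd, fun z hz hz1 => ?_⟩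
    filter_upwards [Lp.coeFn_sub (Fam z) (G z), hFtube z hz hz1, hGae z hz] with x hx h1 h2
    rw [hx, Pi.sub_apply, h1, h2]
    show _ = (quasiSplit (↥(maximalRealSubfield L)) L (IsCMField.complexConj L) 2).quotFun (truncation ν 𝓕 T (Ec z)) x
    have hfun : truncation ν 𝓕 T (Ec z) = truncation ν 𝓕 T₀ (Ec z) - pseudoEisenstein (band.indicator (w z)) := by
      funext g
      have h3 := truncation_sub_truncation_two ν 𝓕 (lt_of_lt_of_le one_pos hT) hle (Ec z) g
      have hPE : pseudoEisenstein (band.indicator (w z)) g =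
          pseudoEisenstein ({x : (quasiSplit (↥(maximalRealSubfield L)) L (IsCMField.complexConj L) 2).Adelic | T < borelHeight x ∧ borelHeight x ≤ T₀}.indicator
            (borelConstantTerm ν 𝓕 (Ec z))) g := by
        refine congrArg (fun u => pseudoEisenstein u g) ?_
        rw [hband, hlo', hhi']
        funext y
        simp only [Set.indicator_apply, Set.mem_setOf_eq]
        split_ifs with hq
        · rw [hE1 z hz1]
          exact (hCT z hz hz1 _ (by rw [hlo']; exact hq.1) (by rw [hhi']; exact hq.2)).symm
        · rfl
      rw [Pi.sub_apply, hPE, ← h3, sub_sub_cancel]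
    rw [hfun]
    rfl

end Summit.HodgeConjecture.HodgeConjecture.Cruxes.H413.K2E1TruncationLevelChangeFamilyCMTwo

end
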